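import Mathlib
import HarnessLib

/-!
# `RationalShortRootRigidity` — Step 1 helper (m12a): involutive symmetries act on the reduced pair by a common sign

Helper lemma INSIDE the paper proof of crux `stmt-QuantumFields-23124` (`F4SubCurvatureDoor.RationalShortRootRigidity`,
LINE g15-A of planner ym-idea-3; Step 1 = `stub_reduce` (0b): the character `χ`); free-hands menu IV, item (m12a), statement
typed in HOME l15/Helpers23124c.lean as `Helpers.SemiInvariantOfReducedPair` — proved here DEF-FREE with that body verbatim
(`P4 = MvPolynomial (Fin 4) ℝ` spelled out):

**Lemma** (`semiInvariantOfReducedPair`).  Let `g` be an involutive `ℝ`-algebra endomorphism of `ℝ[p₀,…,p₃]` fixing `N` and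
`D ≠ 0`, and let `N = N₀·H`, `D = D₀·H` with `N₀, D₀` coprime.  Then `g D₀ = D₀ ∧ g N₀ = N₀` or `g D₀ = −D₀ ∧ g N₀ = −N₀`.

Proof.  From `g N = N`, `g D = D` one gets `N₀·g D₀ = D₀·g N₀` (cancel `H·g H ≠ 0`; `g` is injective as an involution).
Coprimality gives `D₀ ∣ g D₀` (`IsRelPrime.dvd_of_dvd_mul_left`, `ℝ[p]` is a UFD), and applying `g`, `g D₀ ∣ D₀`; so
`g D₀ = D₀·u` with `u` a unit, i.e. a non-zero constant `C λ` (`MvPolynomial.isUnit_iff_eq_C_of_isReduced`).  Involutivity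
and `g (C λ) = C λ` give `λ² = 1`, so `λ = ±1`, and `N₀·g D₀ = D₀·g N₀` yields the same sign for `N₀`.

Mathlib only; THEOREMS ONLY (no definitions); no named facts; no `sorry`; default heartbeats.  Nothing about the crux 23124, the
route's rung or the Yang–Mills mass gap is proved here.  Free-hands seat `ym-line-frs-p2` g10 (announced on the owner's bus
2026-08-28T20:28Z), `--supports stmt-QuantumFields-23124`.
-/

set_option autoImplicit false

namespace Summit.QuantumFields.YangMills.Theorems.RationalShortRootRigidity

/-- **Involutive symmetries act on the reduced pair by a common sign** (m12a; Step 1 (0b) of the paper proof of 23124).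
The statement is the body of `Helpers.SemiInvariantOfReducedPair` (HOME l15/Helpers23124c.lean) verbatim. [folklore] -/
theorem semiInvariantOfReducedPair :
    ∀ (g : MvPolynomial (Fin 4) ℝ →ₐ[ℝ] MvPolynomial (Fin 4) ℝ) (N D N₀ D₀ H : MvPolynomial (Fin 4) ℝ),
      (∀ x, g (g x) = x) → g N = N → g D = D → D ≠ 0 →
      N = N₀ * H → D = D₀ * H → IsRelPrime N₀ D₀ →
      (g D₀ = D₀ ∧ g N₀ = N₀) ∨ (g D₀ = -D₀ ∧ g N₀ = -N₀) := by
  intro g N D N₀ D₀ H hinv hgN hgD hD hN hDfac hcop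
  have hginj : Function.Injective g := Function.LeftInverse.injective hinv
  have hH0 : H ≠ 0 := by rintro rfl; rw [mul_zero] at hDfac; exact hD hDfac
  have hD₀0 : D₀ ≠ 0 := by rintro rfl; rw [zero_mul] at hDfac; exact hD hDfac
  have hgH0 : g H ≠ 0 := fun h => hH0 (hginj (by rw [h, map_zero]))
  -- `N₀·H = g N₀·g H`, `D₀·H = g D₀·g H`
  have h1 : N₀ * H = g N₀ * g H := by rw [← map_mul, ← hN, hgN]
  have h2 : D₀ * H = g D₀ * g H := by rw [← map_mul, ← hDfac, hgD]
  -- the key identity `N₀·g D₀ = D₀·g N₀`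
  have hkey : N₀ * g D₀ = D₀ * g N₀ := by
    have h3 : (N₀ * g D₀) * (H * g H) = (D₀ * g N₀) * (H * g H) := by
      calc (N₀ * g D₀) * (H * g H) = (N₀ * H) * (g D₀ * g H) := by ring
        _ = (g N₀ * g H) * (D₀ * H) := by rw [h1, h2]
        _ = (D₀ * g N₀) * (H * g H) := by ring
    exact mul_right_cancel₀ (mul_ne_zero hH0 hgH0) h3
  -- `D₀ ∣ g D₀` and `g D₀ ∣ D₀`
  have hd1 : D₀ ∣ g D₀ := hcop.symm.dvd_of_dvd_mul_left ⟨g N₀, hkey⟩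
  have hd2 : g D₀ ∣ D₀ := by
    have := map_dvd g hd1
    rwa [hinv] at this
  obtain ⟨u, hu⟩ := associated_of_dvd_dvd hd1 hd2
  obtain ⟨c, -, hc⟩ := MvPolynomial.isUnit_iff_eq_C_of_isReduced.1 u.isUnit
  -- `g D₀ = D₀ · C c` with `c² = 1`
  have hgD₀ : g D₀ = D₀ * MvPolynomial.C c := by rw [← hu, hc]
  have hgC : g (MvPolynomial.C c) = MvPolynomial.C c := by
    rw [← MvPolynomial.algebraMap_eq]; exact g.commutes c
  have hcc : c * c = 1 := by
    have h4 : D₀ * (MvPolynomial.C c * MvPolynomial.C c) = D₀ * 1 := by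
      calc D₀ * (MvPolynomial.C c * MvPolynomial.C c) = g D₀ * g (MvPolynomial.C c) := by
            rw [hgD₀, hgC, mul_assoc]
        _ = g (D₀ * MvPolynomial.C c) := (map_mul g _ _).symm
        _ = g (g D₀) := by rw [← hgD₀]
        _ = D₀ * 1 := by rw [hinv, mul_one]
    have h5 := mul_left_cancel₀ hD₀0 h4
    rw [← map_mul, ← MvPolynomial.C_1] at h5
    exact MvPolynomial.C_injective _ _ h5
  rcases mul_self_eq_one_iff.1 hcc with h | h
  · left
    rw [h, MvPolynomial.C_1, mul_one] at hgD₀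
    refine ⟨hgD₀, ?_⟩
    rw [hgD₀, mul_comm] at hkey
    exact (mul_left_cancel₀ hD₀0 hkey).symm
  · right
    rw [h, map_neg, MvPolynomial.C_1, mul_neg, mul_one] at hgD₀
    refine ⟨hgD₀, ?_⟩
    rw [hgD₀, mul_neg, mul_comm, ← mul_neg] at hkey
    exact (mul_left_cancel₀ hD₀0 hkey).symm

end Summit.QuantumFields.YangMills.Theorems.RationalShortRootRigidity
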